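import Summits.AtomisticToContinuum.Crystallization.Theorems.FreeSplittingCertificatesStrictSplittingRuleTorusModelGen

/-!
# The joint (r6) sitewise LMI on the hcp torus 6×6×3 (216 sites, 648 coordinates) — model-level forms via the generic-shape model

Route `FreeSplittingCertificates`, crux `StrictSplittingRule` (stmt-AtomisticToContinuum-12560); unit b2b-freesplit-B (block 2b,
PART B, gen 2).  VALUE = certificate / kernel-accepted theorems on a FINITE model — NOT summit progress; nothing here proves the
registered stub `stub_coreJointCoercive` (H12⋆, an infinite-dimensional covariant LMI).

Instantiation of `…TorusModelGen.lean` at `(NK, N1) = (6, 6)` (torus `ℤ₆ × ℤ₆ × ℤ₆`, the 6×6×3 torus of CERT.md §0 — the size of the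
lead's kit job j027933): `supply6 / demand6 / normSqG6 / meanProj6`, reference sites, and the margin `margin663 = 3/500 = 0.006`
(cf. the optimiser's float `λ_min = 0.0060954` for the converged tables j037437 and the gen-0 exactly certified `699/2¹⁷ = 0.00533`,
CERT.md §0/§8).  The transfer form `transfer6` (which needs the table data) is in `…TorusModel663Tables.lean`; the theorems are in
`…TorusModel663A.lean` / `…663B.lean`.  [folklore]
-/

namespace Summit.AtomisticToContinuum.Crystallization.Theorems.StrictSplittingRuleTorusLMI

open Literature.Computation.Certificates

/-- The certified margin `m = 3/500 = 0.006` (identity-normalised, Cartesian norm). -/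
def margin663 : ℚ := 3 / 500

/-- Reference A site `(0,0,0)` of the 6×6×3 torus. -/
def siteA6 : SiteG 6 6 := ((0 : Fin 6), (0 : Fin 6), (0 : Fin 6))
/-- Reference B site `(1,0,0)` of the 6×6×3 torus. -/
def siteB6 : SiteG 6 6 := ((1 : Fin 6), (0 : Fin 6), (0 : Fin 6))

/-- SUPPLY `S_p(u)` (6×6×3). [folklore] -/
def supply6 (p : SiteG 6 6) (u : Fin (dimG 6 6) → ℚ) : ℚ := evalQ (supplyTermsG 6 6 p (thetaListG 6 6 p)) u
/-- DEMAND `D_p(u)` = κ-terms + readout form (6×6×3). [folklore] -/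
def demand6 (p : SiteG 6 6) (u : Fin (dimG 6 6) → ℚ) : ℚ :=
  evalQ (kappaTermsG 6 6 p (thetaListG 6 6 p)) u + evalQ (readoutTermsG 6 6 p (thetaListG 6 6 p) betaTable) u
/-- `‖u‖²_G` (6×6×3). [folklore] -/
def normSqG6 (u : Fin (dimG 6 6) → ℚ) : ℚ := evalQ (normTermsG 6 6) u
/-- `meanProj u = Σ_c (g_c/216)(Σ_q u_(q,c))²` (6×6×3). [folklore] -/
def meanProj6 (u : Fin (dimG 6 6) → ℚ) : ℚ := evalQ (projTermsG 6 6) u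

/-- The certificate's form (κ-scaling 1): `S + T − D − m‖u‖² + meanProj`, for any table class list. [folklore] -/
theorem evalQ_certTermsG_663 (p : SiteG 6 6) (mg : ℚ) (tcls : List (Bool × Off × Bool × Bool × List ℤ))
    (u : Fin (dimG 6 6) → ℚ) :
    evalQ (certTermsG 6 6 p 1 mg tcls) u =
      supply6 p u + evalQ (transferTermsG 6 6 p tcls) u - demand6 p u - mg * normSqG6 u + meanProj6 u := by
  simp only [certTermsG, evalQ_append, evalQ_negTermsN, evalQ_scaleTermsN, supply6, demand6, normSqG6, meanProj6]
  ring

/-- `meanProj6` vanishes on zero-mean fields. [folklore] -/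
theorem meanProj6_eq_zero {u : Fin (dimG 6 6) → ℚ} (h0 : ∀ c : Fin 3, (sumFG 6 6 c).eval u = 0) : meanProj6 u = 0 := by
  simp [meanProj6, projTermsG, sqN, evalQ_cons, h0]

end Summit.AtomisticToContinuum.Crystallization.Theorems.StrictSplittingRuleTorusLMI
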